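import Summits.QuantumFields.YangMills.Theorems.BrascampLiebVacuum.Negative.DmaxVolumeBound
import Literature.MathematicalPhysics.QuantumFieldTheory.SliceBottleneck

/-!
# `ConvexGribovBody.BrascampLiebVacuum` is false modulo a weak-coupling SLICE BOTTLENECK —
# the 't Hooft twist-sector witness for non-simply-connected gauge groups

Refuter, route review of `route-QuantumFields-ConvexGribovBody`, crux stmt-QuantumFields-8779
(negative lane; nothing here asserts a Theses statement positively).

The crux `Summit.QuantumFields.YangMills.Theses.ConvexGribovBody.BrascampLiebVacuum` asserts,
for EVERY compact simple `G` (`IsCompactSimpleLieGroup G`: connected, non-abelian, simple,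
linear — finite centre AND non-trivial fundamental group allowed, so `SO(3) = PSU(2)`, `PSU(N)`,
`SO(N)` qualify) and every faithful unitary `r`, a volume-uniform weak-coupling Poincaré
inequality for the time-zero law: `∃ C ∃ β₀ ∀ β ≥ β₀ ∃ S₀ ∀ S ≥ S₀`,
`Var_μ f ≤ C · Dmax(β,S) · dir f` for all gauge-invariant, time-zero-local, link-Lipschitz `f`,
where `dir f = Σ_{ℓ spatial, t=0} ∫ |∇_ℓ f|² dμ` is the single-link metric-slope Dirichlet form
and `Dmax` the minimal-Coulomb-gauge covariance scale. The standing disprover's landed bound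
`dmax_le_volume` (`Dmax ≤ 3 N (2S+1)³`, `Negative/DmaxVolumeBound.lean`) reduces a refutation to
ONE input (its finding F0): admissible `f_S` with `Var/dir ≫ S³` at a FIXED large `β` — "a slow
mode whose Poincaré ratio grows with the volume at fixed weak coupling".

## The input exists for `π₁(G) ≠ 0`: magnetic-flux (twist) sectors of the spatial torus

Take `G = SO(3)` (any faithful `r`). On the time-zero slice — an `SO(3)` lattice gauge field on
the spatial 3-torus `(ℤ/(2S+1))³` — the 't Hooft magnetic flux `m ∈ H²(T³; ℤ₂) ≅ ℤ₂³`
('t Hooft 1979) is defined off a bad event `B_S` = "the ℤ₂-monopoles of the slice do not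
split into isolated neutral clusters of diameter `< S/16`": lift the links to `SU(2)`, read the
signs `η_p = sgn tr_F Ũ_p` (a cocycle off the `ℤ₂`-monopole cubes, each of which has a
far-from-identity face by the Bianchi identity, action `≥ c₀β`), cancel the charges inside each
small neutral cluster along short dual paths, take the class of the resulting cocycle (path- and
lift-independent: differences are contractible dual cycles and coboundaries). It is
(i) a GAUGE-INVARIANT function of the time-zero SPATIAL links only;
(ii) LOCALLY CONSTANT in the link metric `d(U,V) = Σ_e ‖ρ(U_e) − ρ(V_e)‖_F` on the good event,
with the sub-events `A = {m = 0} \ B_S`, `A' = {m = m₁} \ B_S` at `d`-distance `≥ δ₀(θ₀) > 0`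
UNIFORMLY in `S` (nearby configurations have nearby lifts plaquette by plaquette, hence equal
signs off the near-`θ = π` plaquettes; a sign flicker there creates a tight monopole pair that the
cancellation absorbs, so the class is unchanged) — so
`f_S := d(·,A')/(d(·,A)+d(·,A'))` is gauge invariant, time-zero-local, `(3/δ₀)`-Lipschitz in
exactly the crux's metric, `= 1` on `A`, `= 0` on `A'`, and its metric slopes vanish outside a
slightly enlarged bad event `B'_S`;
(iii) at weak coupling `β ≥ β₀` the bad events are small, `μ(B'_S) ≤ C S^{−p(β)}` with
`p(β) → ∞` (multi-scale Peierls for the DILUTE ℤ₂-MONOPOLE GAS of the slice: in 4d the monopole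
current forms closed loops of action `≥ c₀β` per unit length, so the slice sees tight neutral pairs
of density `e^{−c₀β}`; the class is read after cancelling charges inside the canonical
scale-relative isolated neutral clusters (Fröhlich–Spencer type), and is ambiguous or non-local
only if a cluster reaches diameter `≍ S` — one long loop, `e^{−cβS}`, or a forced chain of
`≍ log S` tight pairs, `(C e^{−c₀β})^{log₂ S}`), whence `dir f_S ≤ 3(2S+1)³ (3/δ₀)² μ(B'_S) = o(S^{−6})`
once `β ≥ β₀` — all that the bottleneck needs;
(iv) the sector weights are NON-DEGENERATE on large tori, `μ(A), μ(A') ≥ δ > 0` uniformly in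
`S ≥ S₀(β)`: magnetic fluxes of a pure gauge theory are light — in the confined phase every class
of `H²(T³; π₁(G))` becomes equiprobable as `S → ∞` ('t Hooft's flux classification; flat
"twist-eating" connections carry magnetic twist at zero action; twisted/untwisted partition
function ratios `→ 1`, de Forcrand–von Smekal 2002; sectors all present in periodic `SO(3)`
lattice gauge theory, de Forcrand–Jahn 2003 §4, who define exactly this flux as "a proper SO(3)
observable", note that the sectors disconnect as monopoles are exponentially suppressed for
`β → ∞`, and (§6) that local updates cannot change the twist on lattices larger than `4⁴` — the
classical ergodicity obstruction of `SO(3)` simulations IS this bottleneck).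
Hence `Var f_S ≥ δ²` while `K (2S+1)³ dir f_S → 0` for every `K`: this is the Literature fact
`SliceBottleneckAt SO(3) r` (`Literature/MathematicalPhysics/QuantumFieldTheory/SliceBottleneck.lean`). Input (iv) is physics (as solid as confinement itself; not in
the tree); (i)–(iii) are rigorous on paper but unformalised. For SIMPLY-CONNECTED `G` at weak
coupling no such sector exists (a non-trivial sign class costs a vortex SHEET, mass
`e^{−cβS²}`), so the witness does not bite `SU(N)`, `Sp(N)`, `Spin(N)`, `E₈`.

## What is proved here (sorry-free)

* the input is the Literature fact `Literature.MathematicalPhysics.QuantumFieldTheory.SliceBottleneck`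
  (`SliceBottleneckAt G r` per group; crux vocabulary verbatim; NOT asserted there).
* `brascampLiebVacuum_false_of_sliceBottleneckAt`, `brascampLiebVacuum_false_of_sliceBottleneck`
  — the crux is false modulo the input (composition with `dmax_le_volume`).
* `poincareHypothesis_unsatisfiable_of_sliceBottleneckAt` — at the same `(G, r)` and cofinally
  many `β`, the HYPOTHESIS of the sibling crux `ConvexGribovBody.PoincareToGap` fails for every
  `κ` and `S₀`: that crux is vacuously true there, so the route's `closes` can never be fed at such
  `G` — the conjunction `BrascampLiebVacuum ∧ CovarianceBound` is what dies.

Classification for the planner: the witness exploits GLOBAL topological sectors (`π₁(G) ≠ 0`),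
not the soft-gluon mechanism of the card; minimal repairs: (R1) condition the variance on the
spatial flux class — replace `Var_μ f` by `E_μ Var_μ(f | m)`, `m ∈ H²(T³; π₁(G))` (trivial
σ-algebra for simply-connected `G`) — in `BrascampLiebVacuum` AND in the hypothesis of
`PoincareToGap` (whose proof then also needs sector-independence of local expectations up to
`e^{−cS}`); or (R2) restrict the functional-inequality leg to simply-connected `G` and file the
adjoint-type groups as a separate item. Barrier candidate: "no volume-uniform Poincaré /
log-Sobolev inequality for gauge-invariant functions w.r.t. single-link Dirichlet forms on tori
when `π₁(G) ≠ 0`" (same bottleneck shape as the twist inputs of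
`Theorems/SusceptibilityToPoincare/Negative/TwistSectorSimplyConnected.lean`).
-/

noncomputable section

open scoped BigOperators Topology
open Filter MeasureTheory
open Literature.MathematicalPhysics.QuantumFieldTheory

namespace Summit.QuantumFields.YangMills.Theorems.BrascampLiebVacuum.Negative

/-- Real-number core: `V ≤ C·D·d`, `D ≤ 3 n L³`, `0 ≤ d`, `0 < C` and `C·(3n)·L³·d < V` clash.
[folklore] -/
theorem false_of_bounds {V D C n L3 d : ℝ} (hC : 0 < C) (hd : 0 ≤ d) (hle : V ≤ C * D * d)
    (hD : D ≤ 3 * n * L3) (hlt : C * (3 * n) * L3 * d < V) : False := by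
  have h1 : C * D * d ≤ C * (3 * n * L3) * d :=
    mul_le_mul_of_nonneg_right (mul_le_mul_of_nonneg_left hD hC.le) hd
  have h2 : C * (3 * n * L3) * d = C * (3 * n) * L3 * d := by ring
  linarith

variable {G : Type} [Group G] [TopologicalSpace G] [IsTopologicalGroup G] [CompactSpace G]
  [MeasurableSpace G] [BorelSpace G]

/-- **The crux is false modulo the slice bottleneck at an admissible `(G, r)`**: from
`BrascampLiebVacuum` take `C, β₀`; the bottleneck supplies `β ≥ β₀`, then — against the crux's
`S₀(β)` and the budget `K = C · 3N` — a torus `S ≥ S₀` and an admissible `f` with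
`C · 3N(2S+1)³ · dir f < Var f ≤ C · Dmax · dir f ≤ C · 3N(2S+1)³ · dir f` (`dmax_le_volume`).
[folklore] -/
theorem brascampLiebVacuum_false_of_sliceBottleneckAt (hG : IsCompactSimpleLieGroup G)
    (r : LatticeRep G) (h : SliceBottleneckAt G r) :
    ¬ Summit.QuantumFields.YangMills.Theses.ConvexGribovBody.BrascampLiebVacuum := by
  intro hBL
  obtain ⟨C, hC, β₀, hβ⟩ := hBL G hG r
  obtain ⟨β, hβ₀, hK⟩ := h β₀
  obtain ⟨S₀, hS₀⟩ := hβ β hβ₀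
  obtain ⟨S, hS, f, hf₁, hf₂, hf₃, hlt⟩ := hK (C * (3 * (r.N : ℝ))) S₀
  have hle := hS₀ S hS f hf₁ hf₂ hf₃
  have hD : _ ≤ 3 * (r.N : ℝ) * (2 * S + 1 : ℝ) ^ 3 := dmax_le_volume r β S
  refine false_of_bounds hC ?_ hle hD hlt
  refine Finset.sum_nonneg fun e _ => ?_
  split_ifs
  · exact integral_nonneg fun U => sq_nonneg _
  · exact le_rfl

/-- **The crux is false modulo `SliceBottleneck`.** [folklore] -/
theorem brascampLiebVacuum_false_of_sliceBottleneck (h : SliceBottleneck) :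
    ¬ Summit.QuantumFields.YangMills.Theses.ConvexGribovBody.BrascampLiebVacuum := by
  obtain ⟨w⟩ := h
  exact @brascampLiebVacuum_false_of_sliceBottleneckAt w.G w.grp w.top w.topGrp w.cpt w.meas
    w.borel w.simple w.r w.bottleneck

/-- **At a bottleneck `(G, r)` the Poincaré hypothesis of `ConvexGribovBody.PoincareToGap` is
unsatisfiable** (verbatim shape) for cofinally many `β`, every constant `κ` and every threshold
`S₀`: that crux holds vacuously there, and the route's glue (`BrascampLiebVacuum ∧ CovarianceBound
⇒` the hypothesis with `κ = C·D`) cannot be fed. [folklore] -/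
theorem poincareHypothesis_unsatisfiable_of_sliceBottleneckAt (r : LatticeRep G)
    (h : SliceBottleneckAt G r) (β₀ : ℝ) :
    ∃ β : ℝ, β₀ ≤ β ∧ ∀ κ : ℝ, ∀ S₀ : ℕ, ¬ (∀ S : ℕ, S₀ ≤ S →
      let μ := wilsonMeasure (d := 4) (L := 2 * S + 1) r.ρ β
      let fro : Matrix (Fin r.N) (Fin r.N) ℂ → ℝ := fun M => ∑ a, ∑ b, ‖M a b‖ ^ 2
      let slope : (GaugeConfig 4 (2 * S + 1) G → ℝ) → GaugeConfig 4 (2 * S + 1) G →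
          Edge 4 (2 * S + 1) → ℝ := fun f U e =>
        Filter.limsup (fun g : G => |f (Function.update U e g) - f U| /
          Real.sqrt (fro (r.ρ g - r.ρ (U e)))) (𝓝[≠] (U e))
      let dir : (GaugeConfig 4 (2 * S + 1) G → ℝ) → ℝ := fun f =>
        ∑ e : Edge 4 (2 * S + 1), (if e.1 0 = 0 ∧ e.2 ≠ 0 then ∫ U, (slope f U e) ^ 2 ∂μ else 0)
      ∀ f : GaugeConfig 4 (2 * S + 1) G → ℝ, IsGaugeInvariant f →
        (∀ U V : GaugeConfig 4 (2 * S + 1) G,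
          (∀ e : Edge 4 (2 * S + 1), e.1 0 = 0 → e.2 ≠ 0 → U e = V e) → f U = f V) →
        (∃ K : ℝ, ∀ U V : GaugeConfig 4 (2 * S + 1) G,
          |f U - f V| ≤ K * ∑ e, Real.sqrt (fro (r.ρ (U e) - r.ρ (V e)))) →
        ∫ U, (f U - ∫ V, f V ∂μ) ^ 2 ∂μ ≤ κ * dir f) := by
  obtain ⟨β, hβ₀, hK⟩ := h β₀
  refine ⟨β, hβ₀, fun κ S₀ hP => ?_⟩
  obtain ⟨S, hS, f, hf₁, hf₂, hf₃, hlt⟩ := hK (max κ 0) S₀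
  have hle := hP S hS f hf₁ hf₂ hf₃
  have hdir : 0 ≤ ∑ e : Edge 4 (2 * S + 1), (if e.1 0 = 0 ∧ e.2 ≠ 0 then
      ∫ U, (Filter.limsup (fun g : G => |f (Function.update U e g) - f U| /
        Real.sqrt ((fun M : Matrix (Fin r.N) (Fin r.N) ℂ => ∑ a, ∑ b, ‖M a b‖ ^ 2)
          (r.ρ g - r.ρ (U e)))) (𝓝[≠] (U e))) ^ 2
        ∂(wilsonMeasure (d := 4) (L := 2 * S + 1) r.ρ β) else 0) := by
    refine Finset.sum_nonneg fun e _ => ?_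
    split_ifs
    · exact integral_nonneg fun U => sq_nonneg _
    · exact le_rfl
  have hcube : (1 : ℝ) ≤ (2 * S + 1 : ℝ) ^ 3 := one_le_pow₀ (by norm_cast; omega)
  have hκ : κ ≤ max κ 0 * (2 * S + 1 : ℝ) ^ 3 :=
    (le_max_left κ 0).trans (le_mul_of_one_le_right (le_max_right κ 0) hcube)
  have := mul_le_mul_of_nonneg_right hκ hdir
  linarith

end Summit.QuantumFields.YangMills.Theorems.BrascampLiebVacuum.Negative

end
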